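/-
Copyright (c) 2026 the pub-hodgecm-mathlib formalisation cell (harness21).  Prover seat hodgecm-mathlib-F0P3a-p07 (g15) ((Cnt2′) chair): «S3-ram» seeding wave
(LEAD F0P3a-plan (g13); (α) block-law keeper F0P3a-p06 (g16)), depth dictionary PART 4: the SIGN ↔ RESIDUE-SQUARE bridge for the A-odd ∕ C cells (RULING (17)); 2026-09-02.
-/
import Literature.NumberTheory.Rogawski1990.DepthZeroKappaTransferTypeTwoRamifiedDepthDictionary   -- PART 2 (this seat, ★ p849164): `typeTwo_depthDictionary_hypotheses`; brings ★ B-p14 sign dictionary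
import HarnessLib

/-!
# The ramified type-(2) transfer, depth dictionary PART 4: `(β, θ)_v = 1 ⟺ χ_g(u)_w ∕ ϖ^{2m}` is a residue SQUARE (odd `m`) (Rogawski 1990 §4.9; Serre V §3)

Topic `NumberTheory/Rogawski1990`; namespace `Literature.NumberTheory.Rogawski1990`.  THEOREMS ONLY (no definition, no instance, no notation, no named fact, no `sorry`); kernel lane
`--supports stmt-HodgeConjecture-24833`.  Cell `pub/hodgecm-mathlib` (D-0151), crux H413; road «S3-ram» (count-neutral).  In the A-odd ∕ C branch of the (α) block-law skeleton
(`m = N = 2n+1`) the keeper's joint cells `stub_Zpair_{zero,pm}_odd_A` pair the two literals by the sign `HS = (β,θ)_v`; the root censuses of the pens read the residual datum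
`c̄₀ = res(χ_g(u)_w ∕ ϖ^{2m}) = det B̄_W` (chair RULING (17): «favourable root = has null lines = hyp iff `χ(c̄₀) = 1`»).  THIS FILE is the one-line bridge, in the J0diff's own
binders and in VALUATION currency (no residue field in the statement): for ODD `m`,
**`(β,θ)_v = 1 ⟺ ∃ z, |z|_w = 1 ∧ |χ_g(u)_w ∕ ϖ^{2m} − z²|_w < 1`** and **`(β,θ)_v = −1 ⟺ ¬(…)`** — ★ `quadraticChar_residue_eq_hilbertSymbol_typeTwo_of_ramified` (B-p14) with
`(−1)^{m+1} = 1`, `χ(ā) = 1 ⟺ ā ∈ 𝓀ˣ²` and ★ `isSquare_residue_iff_exists_valued_sub_sq_lt_one`.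
HONEST LABEL: HC_CM is proved only modulo the 2 remaining named inputs (hLiu418 24832, h413 24833) until rung 0 closes; unconditional local algebra at one place, count-neutral.

## References
* [Rogawski1990] J. D. Rogawski, *Automorphic Representations of Unitary Groups in Three Variables*, Ann. of Math. Stud. 123 (1990), §4.9 pp. 55, 59, Prop. 4.9.1 (b).
* [Serre1979] J.-P. Serre, *Local Fields*, GTM 67 (1979), Ch. V §3 Cor. 2, Ch. XIV §3 Prop. 8.
-/

set_option autoImplicit false

noncomputable section

open NumberField IsDedekindDomain ValuativeRel Matrix Polynomial
open Literature.NumberTheory.Automorphic Literature.NumberTheory.Automorphic.UnitaryGroup Literature.NumberTheory.QuadraticForms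
open Literature.NumberTheory.GaloisRepresentations (HeckeCharacter)
open scoped ValuativeRel MatrixGroups

namespace Literature.NumberTheory.Rogawski1990

section Sign

variable (L : Type) [Field L] [NumberField L] [IsCMField L] {v : HeightOneSpectrum (𝓞 ↥(maximalRealSubfield L))}
  (w : PlacesOver L v) (hw : IsCMField.complexConj L • w.1 = w.1)

include hw in
/-- **SIGN ↔ RESIDUE SQUARE, abstract carriers** (`|u − 1|, |δ − 1| < 1`, `|c| = |ϖ^{2m}|`, `m` ODD, `ι_w β = −c(u²+δ)∕(2u²δ)`):
**`(β,θ)_v = 1 ⟺ ∃ z, |z| = 1 ∧ |c∕ϖ^{2m} − z²| < 1`**. [cite: Rogawski1990, §4.9 p. 59] [cite: Serre1979, Ch. V §3 Cor. 2] -/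
theorem hilbertSymbol_typeTwo_eq_one_iff_exists_sq_of_odd (he : v.asIdeal.ramificationIdx' w.1.asIdeal ≠ 1) (h2 : IsUnit (2 : 𝒪[(w.1.adicCompletion L)]))
    (ϖ : w.1.adicCompletion L) (hϖ : Valued.v ϖ = WithZero.exp (-1 : ℤ)) (hσϖ : galAdicCompletionMap (L := L) (IsCMField.complexConj L) hw ϖ = -ϖ)
    {u δ c : w.1.adicCompletion L} (hu1 : Valued.v (u - 1) < 1) (hδ1 : Valued.v (δ - 1) < 1)
    {m : ℕ} (hm : Odd m) (hc : Valued.v c = Valued.v (ϖ ^ (2 * m)))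
    (β : (v.adicCompletion ↥(maximalRealSubfield L))ˣ)
    (hβ : toPlace v w (β : v.adicCompletion ↥(maximalRealSubfield L)) = -(c * (u ^ 2 + δ)) / (2 * u ^ 2 * δ)) :
    hilbertSymbol (v.adicCompletion ↥(maximalRealSubfield L)) (β : v.adicCompletion ↥(maximalRealSubfield L))
        (algebraMap ↥(maximalRealSubfield L) _ ((cmQuadraticGenerator L : 𝓞 ↥(maximalRealSubfield L)) : ↥(maximalRealSubfield L))) = 1 ↔
      ∃ z : w.1.adicCompletion L, Valued.v z = 1 ∧ Valued.v (c / ϖ ^ (2 * m) - z ^ 2) < 1 := by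
  classical
  haveI : Fintype 𝓀[w.1.adicCompletion L] := Fintype.ofFinite _
  have h2v : Valued.v (2 : w.1.adicCompletion L) = 1 := (isUnit_two_integer_iff_valued_eq_one L w.1).1 h2
  have hϖ0 : ϖ ≠ 0 := fun h => by rw [h, map_zero] at hϖ; exact WithZero.zero_ne_coe hϖ
  have hP0 : ϖ ^ (2 * m) ≠ 0 := pow_ne_zero _ hϖ0
  have hvP0 : Valued.v (ϖ ^ (2 * m)) ≠ 0 := (Valuation.ne_zero_iff _).2 hP0
  -- the unit part `c₀ = c ∕ ϖ^{2m}`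
  have hvc₀ : Valued.v (c / ϖ ^ (2 * m)) = 1 := by rw [map_div₀, hc, div_self hvP0]
  have hc₀O : c / ϖ ^ (2 * m) ∈ 𝒪[w.1.adicCompletion L] := (v_le_one_iff_mem_integer _).1 hvc₀.le
  have hcfac : c = ((⟨c / ϖ ^ (2 * m), hc₀O⟩ : 𝒪[w.1.adicCompletion L]) : w.1.adicCompletion L) * ϖ ^ (2 * m) := by
    change c = c / ϖ ^ (2 * m) * ϖ ^ (2 * m); rw [div_mul_cancel₀ _ hP0]
  have key := quadraticChar_residue_eq_hilbertSymbol_typeTwo_of_ramified L w hw he h2v ϖ hϖ hσϖ hu1 hδ1 ⟨c / ϖ ^ (2 * m), hc₀O⟩ hvc₀ m hcfac β hβ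
  rw [Even.neg_one_pow (hm.add_one), one_mul] at key
  have hres0 : IsLocalRing.residue 𝒪[w.1.adicCompletion L] ⟨c / ϖ ^ (2 * m), hc₀O⟩ ≠ 0 := by
    rw [Ne, residue_eq_zero_iff_valuation_lt_one, ← v_lt_one_iff_valuation_lt_one]
    change ¬ Valued.v (c / ϖ ^ (2 * m)) < 1
    rw [hvc₀]; exact lt_irrefl _
  rw [← key]
  constructor
  · intro h1
    have hsq : IsSquare (IsLocalRing.residue 𝒪[w.1.adicCompletion L] ⟨c / ϖ ^ (2 * m), hc₀O⟩) :=
      (quadraticChar_one_iff_isSquare hres0).1 (by exact_mod_cast h1)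
    obtain ⟨r, hr1, hr⟩ := (Literature.NumberTheory.LocalFields.RamifiedPlaceNormDictionary.isSquare_residue_iff_exists_valued_sub_sq_lt_one
      L v w hvc₀).1 hsq
    -- `r` is a unit
    have hvr : Valued.v r = 1 := by
      by_contra hne
      have hlt : Valued.v r < 1 := lt_of_le_of_ne hr1 hne
      have hr2 : Valued.v (r ^ 2) < 1 := by rw [map_pow]; exact pow_lt_one₀ zero_le hlt two_ne_zero
      have : Valued.v (c / ϖ ^ (2 * m) - r ^ 2) = 1 := by
        rw [sub_eq_add_neg, Valuation.map_add_eq_of_lt_left _ (by rwa [Valuation.map_neg, hvc₀]), hvc₀]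
      rw [this] at hr; exact lt_irrefl _ hr
    exact ⟨r, hvr, hr⟩
  · rintro ⟨z, hz1, hz⟩
    have hsq : IsSquare (IsLocalRing.residue 𝒪[w.1.adicCompletion L] ⟨c / ϖ ^ (2 * m), hc₀O⟩) :=
      (Literature.NumberTheory.LocalFields.RamifiedPlaceNormDictionary.isSquare_residue_iff_exists_valued_sub_sq_lt_one L v w hvc₀).2 ⟨z, hz1.le, hz⟩
    exact_mod_cast (quadraticChar_one_iff_isSquare hres0).2 hsq

include hw in
/-- Companion: for ODD `m`, **`(β,θ)_v = −1 ⟺ ¬ ∃ z, |z| = 1 ∧ |c∕ϖ^{2m} − z²| < 1`** (the symbol of a unit is `±1`). [cite: Rogawski1990, §4.9 p. 59] [cite: Serre1979, Ch. XIV §3 Prop. 8] -/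
theorem hilbertSymbol_typeTwo_eq_neg_one_iff_not_exists_sq_of_odd (he : v.asIdeal.ramificationIdx' w.1.asIdeal ≠ 1) (h2 : IsUnit (2 : 𝒪[(w.1.adicCompletion L)]))
    (ϖ : w.1.adicCompletion L) (hϖ : Valued.v ϖ = WithZero.exp (-1 : ℤ)) (hσϖ : galAdicCompletionMap (L := L) (IsCMField.complexConj L) hw ϖ = -ϖ)
    {u δ c : w.1.adicCompletion L} (hu1 : Valued.v (u - 1) < 1) (hδ1 : Valued.v (δ - 1) < 1)
    {m : ℕ} (hm : Odd m) (hc : Valued.v c = Valued.v (ϖ ^ (2 * m)))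
    (β : (v.adicCompletion ↥(maximalRealSubfield L))ˣ)
    (hβ : toPlace v w (β : v.adicCompletion ↥(maximalRealSubfield L)) = -(c * (u ^ 2 + δ)) / (2 * u ^ 2 * δ)) :
    hilbertSymbol (v.adicCompletion ↥(maximalRealSubfield L)) (β : v.adicCompletion ↥(maximalRealSubfield L))
        (algebraMap ↥(maximalRealSubfield L) _ ((cmQuadraticGenerator L : 𝓞 ↥(maximalRealSubfield L)) : ↥(maximalRealSubfield L))) = -1 ↔
      ¬ ∃ z : w.1.adicCompletion L, Valued.v z = 1 ∧ Valued.v (c / ϖ ^ (2 * m) - z ^ 2) < 1 := by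
  rw [← hilbertSymbol_typeTwo_eq_one_iff_exists_sq_of_odd L w hw he h2 ϖ hϖ hσϖ hu1 hδ1 hm hc β hβ]
  have hβ0 : (β : v.adicCompletion ↥(maximalRealSubfield L)) ≠ 0 := β.ne_zero
  constructor
  · intro h h1; rw [h1] at h; norm_num at h
  · intro h
    by_cases hN : ∃ z : w.1.adicCompletion L, galAdicCompletionMap (L := L) (IsCMField.complexConj L) hw z * z = toPlace v w (β : v.adicCompletion ↥(maximalRealSubfield L))
    · exact absurd ((hilbertSymbol_eq_one_iff_exists_norm_toPlace L v w hw hβ0).2 hN) h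
    · exact (hilbertSymbol_eq_neg_one_iff_not_exists_norm_toPlace L v w hw hβ0).2 hN

include hw in
/-- **SIGN ↔ RESIDUE SQUARE in the J0diff binders** (`hblk hu2 hm hβ` VERBATIM, `m` ODD — regimes B and A-odd ∕ C): **`(β,θ)_v = 1 ⟺ ∃ z, |z|_w = 1 ∧ |χ_g(u)_w ∕ ϖ^(2m) − z²|_w < 1`**.
[cite: Rogawski1990, §4.9 pp. 55, 59] [cite: Serre1979, Ch. V §3 Cor. 2] -/
theorem typeTwo_hilbertSymbol_eq_one_iff_exists_sq_ram (he : v.asIdeal.ramificationIdx' w.1.asIdeal ≠ 1) (h2 : IsUnit (2 : 𝒪[(w.1.adicCompletion L)]))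
    (ϖ : w.1.adicCompletion L) (hϖ : Valued.v ϖ = WithZero.exp (-1 : ℤ)) (hσϖ : galAdicCompletionMap (L := L) (IsCMField.complexConj L) hw ϖ = -ϖ)
    ⦃γH : ((cmDatum L 2 (Matrix.of fun i j : Fin 2 => if i.val + j.val + 1 = 2 then (1 : L) else 0)).Local v × (cmDatum L 1 (Matrix.of fun i j : Fin 1 => if i.val + j.val + 1 = 1 then (1 : L) else 0)).Local v)⦄
    (hblk : ∀ i j : Fin 2, Valued.v (((((γH.1.val : GL (Fin 2) (UnitaryGroup.LocalRing L v)).val.map (Pi.evalRingHom (fun w' : PlacesOver L v => w'.1.adicCompletion L) w))) - 1) i j) ≤ Valued.v (ϖ ^ 2)) (hu2 : Valued.v (finGammaTwo L v γH w - 1) ≤ Valued.v (ϖ ^ 2))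
    {m : ℕ} (hodd : Odd m) (hm : Valued.v (((finCharpolyTwo L v γH).eval (finGammaTwo L v γH)) w) = Valued.v ((toPlace v w (HeckeCharacter.uniformizer ↥(maximalRealSubfield L) v : v.adicCompletion ↥(maximalRealSubfield L))) ^ m))
    (β : (v.adicCompletion ↥(maximalRealSubfield L))ˣ)
    (hβ : toPlace v w (β : v.adicCompletion ↥(maximalRealSubfield L)) =
      -(((finCharpolyTwo L v γH).eval (finGammaTwo L v γH)) w * (finGammaTwo L v γH w ^ 2 + ((γH.1.val.val : Matrix (Fin 2) (Fin 2) (LocalRing L v)).map (Pi.evalRingHom (fun w' : PlacesOver L v => w'.1.adicCompletion L) w)).det)) / (2 * finGammaTwo L v γH w ^ 2 * ((γH.1.val.val : Matrix (Fin 2) (Fin 2) (LocalRing L v)).map (Pi.evalRingHom (fun w' : PlacesOver L v => w'.1.adicCompletion L) w)).det)) :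
    hilbertSymbol (v.adicCompletion ↥(maximalRealSubfield L)) (β : v.adicCompletion ↥(maximalRealSubfield L))
        (algebraMap ↥(maximalRealSubfield L) _ ((cmQuadraticGenerator L : 𝓞 ↥(maximalRealSubfield L)) : ↥(maximalRealSubfield L))) = 1 ↔
      ∃ z : w.1.adicCompletion L, Valued.v z = 1 ∧ Valued.v (((finCharpolyTwo L v γH).eval (finGammaTwo L v γH)) w / ϖ ^ (2 * m) - z ^ 2) < 1 := by
  have hϖ2lt : Valued.v (ϖ ^ 2) < 1 := by
    rw [map_pow, hϖ, ← WithZero.exp_nsmul, ← WithZero.exp_zero]; exact WithZero.exp_lt_exp.2 (by norm_num)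
  have hu1 : Valued.v (finGammaTwo L v γH w - 1) < 1 := lt_of_le_of_lt hu2 hϖ2lt
  set g : Matrix (Fin 2) (Fin 2) (w.1.adicCompletion L) := (((γH.1.val : GL (Fin 2) (UnitaryGroup.LocalRing L v)).val.map (Pi.evalRingHom (fun w' : PlacesOver L v => w'.1.adicCompletion L) w))) with hgdef
  have hent : ∀ i j : Fin 2, Valued.v ((g - 1) i j) < 1 := fun i j => lt_of_le_of_lt (hblk i j) hϖ2lt
  have hdet : g.det - 1 = (g - 1) 0 0 * (g - 1) 1 1 + (g - 1) 0 0 + (g - 1) 1 1 - (g - 1) 0 1 * (g - 1) 1 0 := by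
    rw [Matrix.det_fin_two, Matrix.sub_apply, Matrix.sub_apply, Matrix.sub_apply, Matrix.sub_apply, Matrix.one_apply_eq, Matrix.one_apply_eq,
      Matrix.one_apply_ne (by decide : (0 : Fin 2) ≠ 1), Matrix.one_apply_ne (by decide : (1 : Fin 2) ≠ 0)]; ring
  have hmul : ∀ a b : w.1.adicCompletion L, Valued.v a < 1 → Valued.v b < 1 → Valued.v (a * b) < 1 := fun a b ha hb => by
    rw [map_mul]; exact mul_lt_one_of_lt_of_le ha hb.le
  have hδ1 : Valued.v (g.det - 1) < 1 := by
    rw [hdet]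
    refine Valuation.map_sub_lt _ (Valuation.map_add_lt _ (Valuation.map_add_lt _ (hmul _ _ (hent 0 0) (hent 1 1)) (hent 0 0)) (hent 1 1)) ?_
    exact hmul _ _ (hent 0 1) (hent 1 0)
  have hvP : Valued.v (toPlace v w (HeckeCharacter.uniformizer ↥(maximalRealSubfield L) v : v.adicCompletion ↥(maximalRealSubfield L))) = WithZero.exp (-2 : ℤ) :=
    (valued_toPlace_uniformizer_of_ramified L (IsCMField.complexConj L) (IsCMField.complexConj_ne_one L) w hw he).1
  have hc : Valued.v (((finCharpolyTwo L v γH).eval (finGammaTwo L v γH)) w) = Valued.v (ϖ ^ (2 * m)) := by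
    rw [hm, map_pow, hvP, map_pow, hϖ, ← WithZero.exp_nsmul, ← WithZero.exp_nsmul]; congr 1; ring
  exact hilbertSymbol_typeTwo_eq_one_iff_exists_sq_of_odd L w hw he h2 ϖ hϖ hσϖ hu1 hδ1 hodd hc β hβ

end Sign

end Literature.NumberTheory.Rogawski1990

end
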